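import Summits.QuantumFields.BalabanUV.Beta.BorderedHessianStepSlot
import Summits.QuantumFields.BalabanUV.Beta.BorderedHessianStepParity

/-!
# «SLOT-BHK» parity — the step slot `bhKStepOf d lin Lc j` is sgn-SYMMETRIC at every level for EVERY border operator `lin`, hence its
# commutator with any diagonal kernel and the END's symmetrised remainder shape are row-parity-odd (slot-generic twin of
# `BorderedHessianStepParity` §1–§2; binder row D1, leaf row «HP-SYM-SLOTS», R-D1-g25-2 (3))

HONEST FRAMING (cell charter, verbatim): «discharging BetaPertH makes Balaban's UV stability UNCONDITIONAL — a real
constructive-QFT result; it is NOT the continuum limit and NOT the Clay problem.»  DERIVED cell leaf (pub-balaban β sub-cell, binder row D1,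
cross-cell idle seat `b2b-balaban-t4-ne7b-formalise-leaf-05` gen 22; the optional parity § suggested by the base module's author in XREAD
C-ne9leaf03g34-2 INFO-2); [folklore] bookkeeping over tree objects BY NAME; no statement of Bałaban's papers, no `[cite:]` tag, no `def`, no
`Prop` fact; instantiates NO binder of the β-function wall.  NOT D1, NOT `BetaPertH`; NOT continuum; NOT Clay.
HONEST DEPENDENCY (cell records, verbatim): «continuum YM on T⁴ ⇐ BetaPertH ∧ nine spine estimates (0/9 proved); BetaPertH ⇐ (D1) ∧ (D4) ∧
CAP+tail; G-an2-4 gates asym, D1 and NE2/3/4.»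

## What is proved (generic `d`, ANY border operator `lin`, blocking `Lc ≥ 1`)
* **`trK_bhKStepOf`**: `∀ j, trK (bhKStepOf d lin Lc j) = sgnK (bhKStepOf d lin Lc j)` — level `0` is t4-ne9-formalise-leaf-03's hypothesis-free
  `trK_bhKOf` (the two border blocks of the slot are each other's negative transpose BY CONSTRUCTION); level `j+1` blockwise exactly as
  d1-formalise-leaf-05's `trK_bhKStepAt` (ff `wVH·E2` by `trK_E2`, fm∕mf `stepScale·bhKOf`, mm `0`).
* `parityOdd_conjV_bhKStepOf_diagK`: `conjV (bhKStepOf d lin Lc j) (diagK Z)` is row-parity-odd for ANY symbol `Z`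
  (`SecondOrderStepRemainder.parityOdd_conjV_diagK_of_even`); `parityOdd_symRemOf`: the remainder shape `½•conjV (bhKStepOf … j) (diagK Z) + ½•(Δ₁ + Δ₂)`
  is row-parity-odd when `Δ₁`, `Δ₂` are.
* CONSISTENCY (`example`s, no new declaration): `trK_bhKStepAt` re-derived through the bridge `bhKStepOf_linAvgAt`.
So the parity feed of the hR contact route (`SpineRecursiveParity` / (W-REM-PAR)) survives ANY re-tabling of the border — in particular the
re-based literal «JsB12Sym»'s, should its K3 author use a re-tabled border at all (the owner's chart (II) keeps the straight `bhK`/`bhKStep`).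
NOT here: the tadpole-null §3 of `BorderedHessianStepParity` (it needs the wall propagators `G_i` and their localisation — instance-specific).

Provenance: b2b-balaban β sub-cell, cross-cell seat b2b-balaban-t4-ne7b-formalise-leaf-05 gen 22, 2026-08-21 (v1); over `BorderedHessianStepSlot`
(this seat, p246090), `BorderedHessianSlot` (t4-ne9-formalise-leaf-03, p245727), `BorderedHessianStepParity` (d1-formalise-leaf-05 gen 5) BY NAME;
no existing file touched.
-/

noncomputable section

open Literature.MathematicalPhysics.QuantumFieldTheory
open Literature.MathematicalPhysics.QuantumFieldTheory.Balaban1983to89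
open Literature.MathematicalPhysics.QuantumFieldTheory.Balaban1983to89.Beta
open ExpKernelCalculus (MKer)
open AffineAveraging (Form1)
open AveragingContoursRooted (linAvgAt)
open OneStepResolventKernel (Fib)
open Summit.QuantumFields.BalabanUV.Beta.TameKernelCalculus
open Summit.QuantumFields.BalabanUV.Beta.BorderedHessian (sgnF sgnF_inl sgnF_inr sgnK sgnK_apply diagK bhKOf trK_bhKOf bhKStepAt
  bhKStepOf bhKStepOf_zero bhKStepOf_linAvgAt bhKStepOf_succ_inl_inl bhKStepOf_succ_fm bhKStepOf_succ_mf bhKStepOf_succ_mm stepScale)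
open Summit.QuantumFields.BalabanUV.Beta.ChartConjugation (conjV)
open Summit.QuantumFields.BalabanUV.Beta.KernelWardRemainderParity (parityOdd_add)
open Summit.QuantumFields.BalabanUV.Beta.SpineRecursiveParity (parityOdd_smul)
open Summit.QuantumFields.BalabanUV.Beta.SecondOrderStepRemainder (parityOdd_conjV_diagK_of_even)
open Summit.QuantumFields.BalabanUV.Beta.BorderedHessianStepParity (trK_E2 trK_bhKStepAt)

namespace Summit.QuantumFields.BalabanUV.Beta.BorderedHessianStepParity

variable {d : ℕ}

/-! ## §1 sgn-symmetry of the step slot at every level -/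

section Sgn

variable (lin : Form1 (d + 1) ℝ → Fin (d + 1) → (Fin (d + 1) → ℤ) → ℝ) (Lc : ℕ) [NeZero Lc]

/-- [folklore] **THE STEP SLOT IS sgn-SYMMETRIC AT EVERY LEVEL, FOR EVERY BORDER OPERATOR**: `trK (bhKStepOf d lin Lc j) = sgnK (bhKStepOf d lin Lc j)`
— level `0` = `trK_bhKOf` (hypothesis-free); level `j+1` blockwise (ff `wVH·E2` by `trK_E2`, fm∕mf `stepScale·bhKOf`, mm `0`), the proof of
`trK_bhKStepAt` with `bhKAt ↦ bhKOf`. -/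
theorem trK_bhKStepOf : ∀ j : ℕ, trK (bhKStepOf d lin Lc j) = sgnK (bhKStepOf d lin Lc j)
  | 0 => by rw [bhKStepOf_zero]; exact trK_bhKOf (d := d) (lin := lin) (N := Lc)
  | j + 1 => by
    have hA := trK_bhKOf (d := d) (lin := lin) (N := Lc)
    have hE := trK_E2 (d := d) Lc (j + 1)
    funext x y a b
    rw [trK_apply, sgnK_apply]
    rcases a with κ | κ <;> rcases b with l | l
    · have e := congrFun (congrFun (congrFun (congrFun hE x) y) (Sum.inl κ)) (Sum.inl l)
      simp only [trK_apply, sgnK_apply, sgnF_inl, one_mul] at e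
      simp only [bhKStepOf_succ_inl_inl, sgnF_inl, one_mul, e]
    · have e := congrFun (congrFun (congrFun (congrFun hA x) y) (Sum.inl κ)) (Sum.inr l)
      rw [trK_apply, sgnK_apply] at e
      rw [bhKStepOf_succ_mf, bhKStepOf_succ_fm, e]
      ring
    · have e := congrFun (congrFun (congrFun (congrFun hA x) y) (Sum.inr κ)) (Sum.inl l)
      rw [trK_apply, sgnK_apply] at e
      rw [bhKStepOf_succ_fm, bhKStepOf_succ_mf, e]
      ring
    · rw [bhKStepOf_succ_mm, bhKStepOf_succ_mm]; ring

/- [folklore] CONSISTENCY (`example`): d1-formalise-leaf-05's `trK_bhKStepAt` through the bridge `bhKStepOf_linAvgAt`. -/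
example (ρ : Fin (d + 1) → ℤ) (j : ℕ) : trK (bhKStepAt d ρ Lc j) = sgnK (bhKStepAt d ρ Lc j) := by
  rw [← bhKStepOf_linAvgAt]; exact trK_bhKStepOf (fun A => linAvgAt ρ A Lc) Lc j

end Sgn

/-! ## §2 Parity of the commutator contact and of the symmetrised remainder shape, over the slot -/

section Parity

variable (lin : Form1 (d + 1) ℝ → Fin (d + 1) → (Fin (d + 1) → ℤ) → ℝ) (Lc : ℕ) [NeZero Lc]

/-- [folklore] **THE COMMUTATOR OF THE STEP SLOT WITH ANY DIAGONAL KERNEL IS ROW-PARITY-ODD** (every level, every border operator, any symbol). -/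
theorem parityOdd_conjV_bhKStepOf_diagK (j : ℕ) (Z : (Fin (d + 1) → ℤ) → Fib d → ℝ) :
    trK (conjV (bhKStepOf d lin Lc j) (diagK Z)) = -sgnK (conjV (bhKStepOf d lin Lc j) (diagK Z)) :=
  parityOdd_conjV_diagK_of_even Z (trK_bhKStepOf lin Lc j)

/-- [folklore] **THE SYMMETRISED REMAINDER SHAPE OVER THE SLOT IS ROW-PARITY-ODD**: `½•conjV (bhKStepOf … j) (diagK Z) + ½•(Δ₁ + Δ₂)` is
parity-odd whenever `Δ₁`, `Δ₂` are (the shape of `parityOdd_symRem`, border re-tabled). -/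
theorem parityOdd_symRemOf (j : ℕ) (Z : (Fin (d + 1) → ℤ) → Fib d → ℝ) {Δ₁ Δ₂ : MKer (d + 1) (Fib d)} (h₁ : trK Δ₁ = -sgnK Δ₁)
    (h₂ : trK Δ₂ = -sgnK Δ₂) :
    trK ((1 / 2 : ℝ) • conjV (bhKStepOf d lin Lc j) (diagK Z) + (1 / 2 : ℝ) • (Δ₁ + Δ₂)) =
      -sgnK ((1 / 2 : ℝ) • conjV (bhKStepOf d lin Lc j) (diagK Z) + (1 / 2 : ℝ) • (Δ₁ + Δ₂)) :=
  parityOdd_add (parityOdd_smul _ (parityOdd_conjV_bhKStepOf_diagK lin Lc j Z)) (parityOdd_smul _ (parityOdd_add h₁ h₂))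

/- [folklore] CONSISTENCY (`example`): `parityOdd_conjV_bhKStepAt_diagK` through the bridge. -/
example (ρ : Fin (d + 1) → ℤ) (j : ℕ) (Z : (Fin (d + 1) → ℤ) → Fib d → ℝ) :
    trK (conjV (bhKStepAt d ρ Lc j) (diagK Z)) = -sgnK (conjV (bhKStepAt d ρ Lc j) (diagK Z)) := by
  rw [← bhKStepOf_linAvgAt]; exact parityOdd_conjV_bhKStepOf_diagK (fun A => linAvgAt ρ A Lc) Lc j Z

end Parity

end Summit.QuantumFields.BalabanUV.Beta.BorderedHessianStepParity

end
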